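import Summits.BirchSwinnertonDyer.BirchSwinnertonDyer.Theorems.ResidualThetaTransportAtTwoThetaLayerLambdaCongruenceAtTwoStarAssembly
import HarnessLib

/-!
# Crux `ThetaLayerLambdaCongruenceAtTwo` (stmt-BirchSwinnertonDyer-20688, route ResidualThetaTransportAtTwo), line
# `birth` v9, stub (C3k): GLUE from ITEM B5 to the lead's index statement (K2) — «index `[Λ : K] ≤ 2`» from
# «`Λ/𝔪Λ` has at most four cosets» (B4, quotient form) and «`c − 1 ≠ 0` on `Λ/𝔪Λ`» (B5) (width seat
# bsd-wall-rtt-p3-w3 g3; `--supports stmt-BirchSwinnertonDyer-20688 --as helper`; closes nothing)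

HONEST FRAMING. Pure subgroup algebra (§1) plus its reading on the period homology with the landed B5 files (§2). No definition,
no named fact; the multiplicity-one input (B4: `Λ/𝔪Λ` has at most `4` elements) enters as an explicit hypothesis in the
concrete shape "two coset representatives". BSD is not proved by any of this.

WHAT. Lines/birth-C3k-plan.md, Addendum 2 (lead g3): (C3k) ⟸ (K2) = «every subgroup `K ≤ Λ = periodHomology N'` containing
`2Λ`, the `T_q^∨λ − a_qλ`, the `U_ℓ^∨λ` and the cusp-negation differences `{∞,γ'∞} − {∞,γ∞}` satisfies `x, y ∉ K ⇒ x − y ∈ K`»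
= B4 ∧ B5. This file proves the implication B4 ∧ B5 ⇒ (K2) in that currency:
* `sub_mem_of_notMem_of_fourCosets` (§1): in any abelian group, if `K₀ ≤ K`, `Λ` meets at most the four `K₀`-cosets of
  `0, v₁, v₂, v₁ + v₂` (`v₁, v₂ ∈ Λ`, `2Λ ⊆ K₀`), and some `u ∈ Λ ∩ K` is NOT in `K₀`, then `x, y ∈ Λ ∖ K ⇒ x − y ∈ K`
  (in `X/K` the image of `Λ` is `{0, p}`).
* `indexTwo_of_fourCosets_of_optimalQuotient` (§2): for `W` (globally minimal, good supersingular at `2`, `Δ_W < 0`), a real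
  `g ∈ S₂(Γ₀(L))`, the optimal-quotient data `(A, Λ_A = c·Λ_g)` and a cyclic isogeny `W → A` (as in `…StarAssembly`), an ideal
  `𝔪 ∋ 2` acting on `g` by even integers, and ANY subgroup `K` of the dual space containing `𝔪 • Λ` and every
  `{∞,(εγε)∞} − {∞,γ∞}`: if `Λ/𝔪Λ` has at most the four cosets of `0, v₁, v₂, v₁+v₂` (B4), then `x, y ∈ Λ ∖ K ⇒ x − y ∈ K`.
  The `u` of §1 is the B5 witness `{∞,(εγ₀ε)∞} − {∞,γ₀∞} ∉ 𝔪Λ` (`…StarEigenform.exists_periodFunctional_iotaConj_sub_notMem_ideal_smul`).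

References: [CremonaAlgorithms1997] §2.10; Lines/birth-C3k-plan.md Addendum 2 (K2).
-/

noncomputable section

-- justification: the `Summit.BirchSwinnertonDyer.BirchSwinnertonDyer.…` path repeats a component (route-file convention)
set_option linter.dupNamespace false

open scoped MatrixGroups ComplexConjugate ModularForm

open CongruenceSubgroup Complex WeierstrassCurve
open Literature.NumberTheory.EllipticCurves Literature.NumberTheory.EllipticCurves.ModularForms
open Literature.NumberTheory.EllipticCurves.Rank1Residual

namespace Summit.BirchSwinnertonDyer.BirchSwinnertonDyer.Theorems.ThetaLayerLambdaCongruenceAtTwo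

/-! ## §1. Four cosets and one forbidden element give index two -/

section Algebra

variable {X : Type*} [AddCommGroup X]

/-- **Index two from four cosets and a witness.** `K₀ ≤ K ≤ X`, `Λ ≤ X` with `2Λ ⊆ K₀` and `Λ` contained in the four
`K₀`-cosets of `0, v₁, v₂, v₁ + v₂` (`v₂ ∈ Λ`); if some `u ∈ Λ ∩ K` is not in `K₀` then `x, y ∈ Λ ∖ K ⇒ x − y ∈ K` (i.e.
`[Λ : Λ ∩ K] ≤ 2`). In `X/K`: the image of `Λ` lies in `{0, p₁, p₂, p₁ + p₂}` and one of `p₁, p₂, p₁ + p₂` is the image `0`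
of `u`, so the image of `Λ` is `{0, p}`. [folklore] -/
theorem sub_mem_of_notMem_of_fourCosets (Λ K₀ K : AddSubgroup X) (hK₀K : K₀ ≤ K) (h2 : ∀ x ∈ Λ, (2 : ℕ) • x ∈ K₀)
    {v₁ v₂ : X} (hv₂ : v₂ ∈ Λ)
    (hcos : ∀ x ∈ Λ, x ∈ K₀ ∨ x - v₁ ∈ K₀ ∨ x - v₂ ∈ K₀ ∨ x - (v₁ + v₂) ∈ K₀)
    {u : X} (huΛ : u ∈ Λ) (huK : u ∈ K) (huK₀ : u ∉ K₀)
    {x y : X} (hx : x ∈ Λ) (hy : y ∈ Λ) (hxK : x ∉ K) (hyK : y ∉ K) : x - y ∈ K := by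
  -- work in `X ⧸ K`
  let π : X →+ X ⧸ K := QuotientAddGroup.mk' K
  have hπ : ∀ z, π z = 0 ↔ z ∈ K := fun z ↦ QuotientAddGroup.eq_zero_iff z
  have hπK₀ : ∀ z ∈ K₀, π z = 0 := fun z hz ↦ (hπ z).mpr (hK₀K hz)
  -- classes of elements of `Λ`
  have hcl : ∀ z ∈ Λ, π z = 0 ∨ π z = π v₁ ∨ π z = π v₂ ∨ π z = π v₁ + π v₂ := fun z hz ↦ by
    rcases hcos z hz with h | h | h | h
    · exact Or.inl (hπK₀ z h)
    · refine Or.inr (Or.inl ?_)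
      have := hπK₀ _ h; rwa [map_sub, sub_eq_zero] at this
    · refine Or.inr (Or.inr (Or.inl ?_))
      have := hπK₀ _ h; rwa [map_sub, sub_eq_zero] at this
    · refine Or.inr (Or.inr (Or.inr ?_))
      have := hπK₀ _ h; rwa [map_sub, sub_eq_zero, map_add] at this
  have h2π : ∀ z ∈ Λ, (2 : ℕ) • π z = 0 := fun z hz ↦ by rw [← map_nsmul]; exact hπK₀ _ (h2 z hz)
  -- one of `π v₁, π v₂, π v₁ + π v₂` vanishes (the `K₀`-coset of `u ∈ K ∖ K₀`), so there is a single class `p`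
  have hu0 : π u = 0 := (hπ u).mpr huK
  have key : ∃ p : X ⧸ K, ∀ z ∈ Λ, π z = 0 ∨ π z = p := by
    rcases hcos u huΛ with h | h | h | h
    · exact absurd h huK₀
    · have hv : π v₁ = 0 := by
        have := hπK₀ _ h
        rw [map_sub, sub_eq_zero] at this
        rw [← this, hu0]
      refine ⟨π v₂, fun z hz ↦ ?_⟩
      rcases hcl z hz with hz' | hz' | hz' | hz'
      · exact Or.inl hz'
      · exact Or.inl (by rw [hz', hv])
      · exact Or.inr hz'
      · exact Or.inr (by rw [hz', hv, zero_add])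
    · have hv : π v₂ = 0 := by
        have := hπK₀ _ h
        rw [map_sub, sub_eq_zero] at this
        rw [← this, hu0]
      refine ⟨π v₁, fun z hz ↦ ?_⟩
      rcases hcl z hz with hz' | hz' | hz' | hz'
      · exact Or.inl hz'
      · exact Or.inr hz'
      · exact Or.inl (by rw [hz', hv])
      · exact Or.inr (by rw [hz', hv, add_zero])
    · have hsum : π v₁ + π v₂ = 0 := by
        have := hπK₀ _ h
        rw [map_sub, sub_eq_zero, map_add] at this
        rw [← this, hu0]
      have h12 : π v₁ = π v₂ := by
        have e2 : (2 : ℕ) • π v₂ = 0 := h2π v₂ hv₂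
        rw [two_nsmul] at e2
        calc π v₁ = π v₁ + π v₂ + π v₂ - (π v₂ + π v₂) := by abel
          _ = π v₂ := by rw [hsum, e2]; abel
      refine ⟨π v₁, fun z hz ↦ ?_⟩
      rcases hcl z hz with hz' | hz' | hz' | hz'
      · exact Or.inl hz'
      · exact Or.inr hz'
      · exact Or.inr (by rw [hz', h12])
      · exact Or.inl (by rw [hz', hsum])
  obtain ⟨p, hp⟩ := key
  have hxp : π x = p := (hp x hx).resolve_left fun h ↦ hxK ((hπ x).mp h)
  have hyp : π y = p := (hp y hy).resolve_left fun h ↦ hyK ((hπ y).mp h)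
  exact (hπ _).mp (by rw [map_sub, hxp, hyp, sub_self])

end Algebra

/-! ## §2. (K2) from B4 (four cosets of `𝔪Λ`) and B5 (landed) -/

section PeriodHomology

/-- **B4 ∧ B5 ⇒ (K2), data level.** `W/ℚ` globally minimal, good supersingular at `2`, `Δ_W < 0`; `g ∈ S₂(Γ₀(L))` with real
coefficients; optimal-quotient data `(A, Λ_A = c·Λ_g, c ∈ ℚ^×)` and a cyclic `ℚ`-isogeny `ψ : W → A` (as in `…StarAssembly`); an
ideal `𝔪 ∋ 2` of `𝕋 = HeckeRing0 L 2` acting on `g` by even integers. Let `K` be ANY subgroup of `S₂(Γ₀(L))^∨` containing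
`𝔪 • Λ` and every cusp-negation difference `{∞,(εγε)∞} − {∞,γ∞}`. If `Λ/𝔪Λ` has at most the four cosets of `0, v₁, v₂, v₁+v₂`
(`v₂ ∈ Λ`) — the quotient form of mod-`2` multiplicity one, B4 — then `x, y ∈ Λ ∖ K ⇒ x − y ∈ K`, i.e. `[Λ : Λ ∩ K] ≤ 2` (K2).
[cite: CremonaAlgorithms1997, §2.10 (pp. 29–30)] -/
theorem indexTwo_of_fourCosets_of_optimalQuotient (W : WeierstrassCurve ℚ) [W.IsElliptic] [W.IsGloballyMinimal]
    (hss : GoodSS W 2) (hΔ : W.Δ < 0) {L : ℕ} [NeZero L] (g : CuspForm (Gamma0 L) 2) (hreal : ∀ n, (cuspCoeff g n).im = 0)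
    (A : WeierstrassCurve ℚ) [A.IsElliptic] {LA : PeriodPair} (hLA : IsNeronLatticeOf (A.baseChange ℂ) LA)
    {c : ℚ} (hc : c ≠ 0) (hlat : ∀ z : ℂ, z ∈ LA.lattice ↔ ∃ w ∈ periodLattice g, z = (c : ℂ) * w)
    (ψ : Isogeny W A) (hcyc : ψ.IsCyclic)
    (𝔪 : Ideal (HeckeRing0 L 2)) (h2 : (2 : HeckeRing0 L 2) ∈ 𝔪)
    (h𝔪 : ∀ t ∈ 𝔪, ∃ e : ℤ, HeckeRing0.toEnd L 2 t g = ((2 * e : ℤ) : ℂ) • g)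
    (K : AddSubgroup (Module.Dual ℂ (CuspForm (Gamma0 L) 2)))
    (hK𝔪 : ∀ x ∈ 𝔪 • periodHomologyHecke L, x ∈ K)
    (hKc : ∀ γ : Gamma0 L, periodFunctional L ⟨iotaConj (γ : SL(2, ℤ)), iotaConj_coe_mem_gamma0 γ⟩ - periodFunctional L γ ∈ K)
    {v₁ v₂ : Module.Dual ℂ (CuspForm (Gamma0 L) 2)} (hv₂ : v₂ ∈ periodHomology L)
    (hcos : ∀ x ∈ periodHomology L, x ∈ 𝔪 • periodHomologyHecke L ∨ x - v₁ ∈ 𝔪 • periodHomologyHecke L ∨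
      x - v₂ ∈ 𝔪 • periodHomologyHecke L ∨ x - (v₁ + v₂) ∈ 𝔪 • periodHomologyHecke L)
    {x y : Module.Dual ℂ (CuspForm (Gamma0 L) 2)} (hx : x ∈ periodHomology L) (hy : y ∈ periodHomology L)
    (hxK : x ∉ K) (hyK : y ∉ K) : x - y ∈ K := by
  -- B5 witness: `u = {∞,(εγ₀ε)∞} − {∞,γ₀∞} ∉ 𝔪Λ`
  obtain ⟨LW, hLW⟩ := exists_isNeronLatticeOf W
  obtain ⟨α, m, hα, hm, hWB, hBW⟩ := exists_real_oddIndex_latticeBridge_of_goodSS_two W A hss ψ hcyc hLW hLA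
  have hc' : (c : ℝ) ≠ 0 := by exact_mod_cast hc
  have hrhg : ∃ z ∈ periodLattice g, ∀ w ∈ periodLattice g, z + conj z ≠ 2 * w :=
    periodLattice_rhombic_of_latticeBridge g (WeierstrassCurve.isReal_of_g₂_g₃_eq (K := ℚ) hLW.1 hLW.2)
      (W.neronLattice_rhombic_of_Δ_neg hΔ hLW) LA.lattice.toAddSubgroup hc'
      (fun z ↦ by rw [Submodule.mem_toAddSubgroup, hlat z, Complex.ofReal_ratCast]) hα hm
      (fun z hz ↦ hWB z hz) (fun b hb ↦ hBW b hb)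
  obtain ⟨γ₀, hγ₀⟩ := exists_periodFunctional_iotaConj_sub_notMem_ideal_smul g hreal 𝔪 h2 h𝔪 hrhg
  -- apply §1 with `Λ = periodHomology`, `K₀ = 𝔪 • Λ` (as a subgroup of the dual space)
  have huΛ : periodFunctional L ⟨iotaConj ((γ₀ : Gamma0 L) : SL(2, ℤ)), iotaConj_coe_mem_gamma0 γ₀⟩ - periodFunctional L γ₀ ∈
      periodHomology L := sub_mem (periodFunctional_mem_periodHomology L _) (periodFunctional_mem_periodHomology L γ₀)
  refine sub_mem_of_notMem_of_fourCosets (periodHomology L) (𝔪 • periodHomologyHecke L).toAddSubgroup K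
    (fun z hz ↦ hK𝔪 z hz) (fun z hz ↦ ?_) hv₂ (fun z hz ↦ hcos z hz) huΛ (hKc γ₀) hγ₀ hx hy hxK hyK
  -- `2Λ ⊆ 𝔪Λ`
  rw [Submodule.mem_toAddSubgroup, ← Nat.cast_smul_eq_nsmul (HeckeRing0 L 2), Nat.cast_ofNat]
  exact Submodule.smul_mem_smul h2 ((mem_periodHomologyHecke L).mpr hz)

end PeriodHomology


end Summit.BirchSwinnertonDyer.BirchSwinnertonDyer.Theorems.ThetaLayerLambdaCongruenceAtTwo

end
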